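import Summits.NavierStokesRegularity.NavierStokesRegularity.Theorems.PowerGaugeEulerLiouville.Negative.NeedleStubBinders

/-!
# Crux E `PowerGaugeEulerLiouville` (stmt-NavierStokesRegularity-19832) — the witness PROFILE against `Sig.stub_selfSimilarC2Needle`
# without its class hypothesis (file 2 of 3, refuter seat ns-regularity-refuter1 g9, KILLSHEET K-63)

The quadratic divergence-free profile `V♯(y) = (y₁², y₂², y₀²)` at `ρ = ¼`: `C^∞`; EXTREMAL (`L^{−1/2}∫_{B_L}|V♯|² ≥ |B_1|/4` for `L ≥ 4`,
on the unit ball about `(L/2)𝐞₀` one has `|V♯|² ≥ y₀⁴ ≥ (L/4)⁴`); NOT tame — fast radial inflow `⟪y, V♯ y⟫ = −t³` at `y = (−t, t, 0)`, not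
uniformly continuous (`V♯(t𝐞₁)₀ = t²`), `(curl V♯)₀(y) = −2y₂ ≠ 0` far out (neither irrotational nor of compactly supported vorticity); NOT
critically homogeneous (degree `2`).  Consumed by file 3 (`SelfSimilarC2NeedleFalseWithoutClass.lean`).

bears_on: N0 stmt-NavierStokesRegularity-19832 (crux E `PowerGaugeEulerLiouville`, OPEN) via the v35 residual stub; consumer = the line's
planner / LEAD (binder hygiene, prover brief).  WHAT THIS IS NOT: not a claim about Navier–Stokes regularity or blow-up; not a refutation of
the stub, of crux E or of the route; no landed theorem is contradicted. [folklore]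
-/

noncomputable section

set_option linter.dupNamespace false

namespace Summit.NavierStokesRegularity.NavierStokesRegularity.Theorems.PowerGaugeEulerLiouville.Negative

open MeasureTheory Set Function Filter Topology Metric
open scoped RealInnerProductSpace NNReal ENNReal Topology ContDiff
open Literature.Analysis Literature.Analysis.FluidPDE

local notation "E3" => EuclideanSpace ℝ (Fin 3)

/-! ## §1 The witness profile `V♯(y) = (y₁², y₂², y₀²)` -/

/-- the standard basis vectors of `ℝ³`. -/
local notation "𝐞₀" => (EuclideanSpace.single (0 : Fin 3) (1 : ℝ) : EuclideanSpace ℝ (Fin 3))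
local notation "𝐞₁" => (EuclideanSpace.single (1 : Fin 3) (1 : ℝ) : EuclideanSpace ℝ (Fin 3))
local notation "𝐞₂" => (EuclideanSpace.single (2 : Fin 3) (1 : ℝ) : EuclideanSpace ℝ (Fin 3))

/-- the coordinate projections of `ℝ³` as continuous linear functionals. -/
local notation "π₀" => (EuclideanSpace.proj (0 : Fin 3) : EuclideanSpace ℝ (Fin 3) →L[ℝ] ℝ)
local notation "π₁" => (EuclideanSpace.proj (1 : Fin 3) : EuclideanSpace ℝ (Fin 3) →L[ℝ] ℝ)
local notation "π₂" => (EuclideanSpace.proj (2 : Fin 3) : EuclideanSpace ℝ (Fin 3) →L[ℝ] ℝ)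

/-- the witness profile `V♯(y) = (y₁², y₂², y₀²)` (a divergence-free quadratic field). -/
def Vw (y : E3) : E3 := (y 1 * y 1) • 𝐞₀ + (y 2 * y 2) • 𝐞₁ + (y 0 * y 0) • 𝐞₂

/-- component `0` of the witness. -/
@[simp] theorem Vw_apply_zero (y : E3) : Vw y 0 = y 1 * y 1 := by
  simp [Vw]

/-- component `1` of the witness. -/
@[simp] theorem Vw_apply_one (y : E3) : Vw y 1 = y 2 * y 2 := by
  simp [Vw]

/-- component `2` of the witness. -/
@[simp] theorem Vw_apply_two (y : E3) : Vw y 2 = y 0 * y 0 := by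
  simp [Vw]

/-- the witness vanishes only at the origin. -/
theorem Vw_eq_zero_iff (y : E3) : Vw y = 0 ↔ y = 0 := by
  constructor
  · intro h
    have h0 := congrArg (fun v : E3 => v 0) h
    have h1 := congrArg (fun v : E3 => v 1) h
    have h2 := congrArg (fun v : E3 => v 2) h
    simp only [Vw_apply_zero, Vw_apply_one, Vw_apply_two, PiLp.zero_apply, mul_self_eq_zero] at h0 h1 h2
    ext i
    fin_cases i <;> simp [h0, h1, h2]
  · intro h
    subst h
    ext i
    fin_cases i <;> simp

/-- the witness is `2`-homogeneous: `V♯ (s • y) = s² • V♯ y`. -/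
theorem Vw_smul (s : ℝ) (y : E3) : Vw (s • y) = (s * s) • Vw y := by
  ext i
  fin_cases i <;> simp <;> ring

/-- the witness is smooth. -/
theorem contDiff_Vw {n : WithTop ℕ∞} : ContDiff ℝ n Vw := by
  have hc : ∀ i : Fin 3, ContDiff ℝ n (fun y : E3 => y i) := fun i =>
    (EuclideanSpace.proj i : EuclideanSpace ℝ (Fin 3) →L[ℝ] ℝ).contDiff
  unfold Vw
  exact ((((hc 1).mul (hc 1)).smul (contDiff_const (c := 𝐞₀))).add
    (((hc 2).mul (hc 2)).smul (contDiff_const (c := 𝐞₁)))).add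
    (((hc 0).mul (hc 0)).smul (contDiff_const (c := 𝐞₂)))

/-- the witness is continuous. -/
theorem continuous_Vw : Continuous Vw := (contDiff_Vw (n := 0)).continuous

/-- the Fréchet derivative of the witness. -/
theorem hasFDerivAt_Vw (x : E3) :
    HasFDerivAt Vw
      (((x 1) • π₁ + (x 1) • π₁).smulRight 𝐞₀ + ((x 2) • π₂ + (x 2) • π₂).smulRight 𝐞₁ +
        ((x 0) • π₀ + (x 0) • π₀).smulRight 𝐞₂) x := by
  have hc : ∀ i : Fin 3, HasFDerivAt (fun y : E3 => y i)
      (EuclideanSpace.proj i : EuclideanSpace ℝ (Fin 3) →L[ℝ] ℝ) x := fun i =>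
    (EuclideanSpace.proj i : EuclideanSpace ℝ (Fin 3) →L[ℝ] ℝ).hasFDerivAt
  unfold Vw
  exact ((((hc 1).mul (hc 1)).smul_const 𝐞₀).add (((hc 2).mul (hc 2)).smul_const 𝐞₁)).add
    (((hc 0).mul (hc 0)).smul_const 𝐞₂)

/-- component `0` of the vorticity of the witness: `(curl V♯)(x)₀ = −2 x₂`. -/
theorem curl_Vw_apply_zero (x : E3) : curl Vw x 0 = -(2 * x 2) := by
  simp only [curl, (hasFDerivAt_Vw x).fderiv]
  simp
  ring

/-- the vorticity of the witness does not vanish at `t • 𝐞₂`, `t ≠ 0`. -/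
theorem curl_Vw_ne_zero {t : ℝ} (ht : t ≠ 0) : curl Vw (t • 𝐞₂) ≠ 0 := by
  intro h
  have h0 := congrArg (fun v : E3 => v 0) h
  simp only [curl_Vw_apply_zero, PiLp.zero_apply] at h0
  simp at h0
  exact ht h0

/-- the witness is not uniformly continuous (`V♯(t 𝐞₁)₀ = t²`). -/
theorem not_uniformContinuous_Vw : ¬ UniformContinuous Vw := by
  intro h
  rcases Metric.uniformContinuous_iff.mp h 1 one_pos with ⟨δ, hδ, hδ'⟩
  set t : ℝ := max 2 (2 / δ) with ht
  have ht2 : 2 ≤ t := le_max_left _ _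
  have htpos : 0 < t := by linarith
  have htδ : 1 / t < δ := by
    have h1 : 2 / δ ≤ t := le_max_right _ _
    rw [div_lt_iff₀ htpos]
    have : 2 ≤ δ * t := by
      calc (2 : ℝ) = δ * (2 / δ) := by field_simp
        _ ≤ δ * t := by gcongr
    linarith
  have hab : dist (t • 𝐞₁) ((t + 1 / t) • 𝐞₁) < δ := by
    rw [dist_eq_norm, ← sub_smul, norm_smul, PiLp.norm_single, norm_one, mul_one, Real.norm_eq_abs]
    have : t - (t + 1 / t) = -(1 / t) := by ring
    rw [this, abs_neg, abs_of_pos (by positivity)]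
    exact htδ
  have h1 := hδ' hab
  have h2 : (2 : ℝ) ≤ dist (Vw (t • 𝐞₁)) (Vw ((t + 1 / t) • 𝐞₁)) := by
    rw [dist_eq_norm]
    refine le_trans ?_ (PiLp.norm_apply_le (Vw (t • 𝐞₁) - Vw ((t + 1 / t) • 𝐞₁)) 0)
    have hcomp : (Vw (t • 𝐞₁) - Vw ((t + 1 / t) • 𝐞₁)) 0 = -(2 + 1 / t ^ 2) := by
      rw [PiLp.sub_apply, Vw_apply_zero, Vw_apply_zero]
      simp
      field_simp
      ring
    rw [hcomp, Real.norm_eq_abs, abs_neg, abs_of_pos (by positivity)]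
    have : 0 ≤ 1 / t ^ 2 := by positivity
    linarith
  linarith

/-- the witness has FAST RADIAL INFLOW far out: no barrier `−κ‖y‖² ≤ ⟪y, V♯ y⟫` with `κ < 1` holds on the complement of a ball
(`⟪y, V♯ y⟫ = −t³` at `y = (−t, t, 0)`). -/
theorem no_radial_barrier_Vw {κ : ℝ} (hκ : κ < 1) (R₁ : ℝ) :
    ¬ ∀ y : E3, R₁ ≤ ‖y‖ → -(κ * ‖y‖ ^ 2) ≤ inner ℝ y (Vw y) := by
  intro h
  set t : ℝ := max 2 (|R₁| + 1) with ht
  have ht2 : 2 ≤ t := le_max_left _ _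
  have htR : |R₁| + 1 ≤ t := le_max_right _ _
  have htpos : 0 < t := by linarith
  set y : E3 := (-t) • 𝐞₀ + t • 𝐞₁ with hy
  have hy0 : y 0 = -t := by simp [hy]
  have hy1 : y 1 = t := by simp [hy]
  have hy2 : y 2 = 0 := by simp [hy]
  have hnorm_sq : ‖y‖ ^ 2 = 2 * t ^ 2 := by
    rw [EuclideanSpace.real_norm_sq_eq, Fin.sum_univ_three, hy0, hy1, hy2]
    ring
  have hnorm_ge : R₁ ≤ ‖y‖ := by
    have h1 : ‖y 1‖ ≤ ‖y‖ := PiLp.norm_apply_le y 1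
    rw [hy1, Real.norm_eq_abs, abs_of_pos htpos] at h1
    linarith [le_abs_self R₁]
  have hinner : inner ℝ y (Vw y) = -t ^ 3 := by
    simp [PiLp.inner_apply, Fin.sum_univ_three, hy0, hy1, hy2]
    ring
  have hh := h y hnorm_ge
  rw [hinner, hnorm_sq] at hh
  nlinarith [mul_pos htpos htpos]

/-- the witness is EXTREMAL at `ρ = ¼`: `L^{−1/2} ∫_{B_L} |V♯|² ≥ |B_1|/4` for `L ≥ 4` (on the unit ball about `(L/2) 𝐞₀`,
`|V♯|² ≥ y₀⁴ ≥ (L/4)⁴`). -/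
theorem isExtremalProfile_Vw : IsExtremalProfile (1 / 4) Vw := by
  have hv : 0 < volume.real (ball (0 : E3) 1) :=
    ENNReal.toReal_pos (measure_ball_pos volume (0 : E3) one_pos).ne' measure_ball_lt_top.ne
  refine ⟨volume.real (ball (0 : E3) 1) / 4, by positivity, 4, fun L hL => ?_⟩
  have hL1 : 1 ≤ L := by linarith
  have hLpos : 0 < L := by linarith
  set c : E3 := (L / 2) • 𝐞₀ with hc
  have hcn : ‖c‖ = L / 2 := by
    rw [hc, norm_smul, PiLp.norm_single, norm_one, mul_one, Real.norm_eq_abs, abs_of_pos (by positivity)]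
  have hsub : ball c 1 ⊆ ball (0 : E3) L := by
    intro y hy
    rw [mem_ball, dist_eq_norm] at hy
    rw [mem_ball, dist_eq_norm, sub_zero]
    calc ‖y‖ = ‖(y - c) + c‖ := by rw [sub_add_cancel]
      _ ≤ ‖y - c‖ + ‖c‖ := norm_add_le _ _
      _ < 1 + L / 2 := by rw [hcn]; linarith
      _ ≤ L := by linarith
  have hlow : ∀ y ∈ ball c 1, (L / 4) ^ 4 ≤ ‖Vw y‖ ^ 2 := by
    intro y hy
    rw [mem_ball, dist_eq_norm] at hy
    have h0c : (y - c) 0 = y 0 - L / 2 := by simp [hc]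
    have h0 : L / 4 ≤ y 0 := by
      have h1 : ‖(y - c) 0‖ ≤ ‖y - c‖ := PiLp.norm_apply_le (y - c) 0
      rw [h0c, Real.norm_eq_abs] at h1
      have h2 := (abs_lt.mp (lt_of_le_of_lt h1 hy)).1
      linarith
    have h0' : 0 ≤ L / 4 := by positivity
    calc (L / 4) ^ 4 ≤ (y 0) ^ 4 := pow_le_pow_left₀ h0' h0 4
      _ = ‖Vw y 2‖ ^ 2 := by rw [Vw_apply_two, Real.norm_eq_abs, sq_abs]; ring
      _ ≤ ‖Vw y‖ ^ 2 := by
          gcongr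
          exact PiLp.norm_apply_le (Vw y) 2
  have hcont : Continuous fun y : E3 => ‖Vw y‖ ^ 2 := (continuous_Vw.norm).pow 2
  have hint : IntegrableOn (fun y : E3 => ‖Vw y‖ ^ 2) (ball (0 : E3) L) volume :=
    (hcont.continuousOn.integrableOn_compact (isCompact_closedBall (0 : E3) L)).mono_set ball_subset_closedBall
  have hint' : IntegrableOn (fun y : E3 => ‖Vw y‖ ^ 2) (ball c 1) volume := hint.mono_set hsub
  have hI : (L / 4) ^ 4 * volume.real (ball (0 : E3) 1) ≤ ∫ y in ball (0 : E3) L, ‖Vw y‖ ^ 2 := by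
    calc (L / 4) ^ 4 * volume.real (ball (0 : E3) 1)
        = ∫ _ in ball c 1, (L / 4) ^ 4 := by
          rw [setIntegral_const, Measure.addHaar_real_ball_center volume c 1, smul_eq_mul, mul_comm]
      _ ≤ ∫ y in ball c 1, ‖Vw y‖ ^ 2 :=
          setIntegral_mono_on (integrableOn_const (measure_ball_lt_top.ne)) hint' measurableSet_ball hlow
      _ ≤ ∫ y in ball (0 : E3) L, ‖Vw y‖ ^ 2 :=
          setIntegral_mono_set hint (Eventually.of_forall fun y => by positivity) hsub.eventuallyLE
  have hrpow : L⁻¹ ≤ L ^ (2 * (1 / 4 : ℝ) - 1) := by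
    rw [← Real.rpow_neg_one]
    exact Real.rpow_le_rpow_of_exponent_le hL1 (by norm_num)
  have hL3 : (64 : ℝ) ≤ L ^ 3 := by nlinarith [mul_pos hLpos hLpos]
  calc volume.real (ball (0 : E3) 1) / 4
      ≤ L⁻¹ * ((L / 4) ^ 4 * volume.real (ball (0 : E3) 1)) := by
        rw [show L⁻¹ * ((L / 4) ^ 4 * volume.real (ball (0 : E3) 1)) =
            (L ^ 3 / 256) * volume.real (ball (0 : E3) 1) by field_simp; ring]
        rw [div_eq_mul_inv, mul_comm]
        gcongr
        linarith
    _ ≤ L ^ (2 * (1 / 4 : ℝ) - 1) * ∫ y in ball (0 : E3) L, ‖Vw y‖ ^ 2 := by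
        gcongr

/-- the witness is NOT critically homogeneous at `ρ = ¼` (it is homogeneous of degree `2`). -/
theorem not_isHomogeneousProfile_Vw : ¬ IsHomogeneousProfile (1 / 4) Vw := by
  intro h
  have hh := congrArg (fun v : E3 => v 0) (h 2 two_pos (𝐞₁))
  simp only [Vw_smul, PiLp.smul_apply, Vw_apply_zero, smul_eq_mul] at hh
  simp at hh
  have h1 : (2 : ℝ) ^ (-(1 + 1 / 4 : ℝ)) ≤ 1 := Real.rpow_le_one_of_one_le_of_nonpos (by norm_num) (by norm_num)
  linarith

/-- the witness is NOT tame at `ρ = ¼`. -/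
theorem not_isTameC2Profile_Vw : ¬ IsTameC2Profile (1 / 4) Vw := by
  rintro ⟨-, h | h | h | h⟩
  · obtain ⟨κ, R₁, hκ, hb⟩ := h
    exact no_radial_barrier_Vw (by linarith [show (1 : ℝ) / (2 + 1 / 4) < 1 by norm_num]) R₁ hb
  · exact not_uniformContinuous_Vw h
  · exact curl_Vw_ne_zero one_ne_zero (h _)
  · obtain ⟨R, hR, hR'⟩ := h.exists_pos_le_norm
    refine curl_Vw_ne_zero (show R ≠ 0 from hR.ne') (hR' _ ?_)
    rw [norm_smul, PiLp.norm_single, norm_one, mul_one, Real.norm_eq_abs, abs_of_pos hR]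


end Summit.NavierStokesRegularity.NavierStokesRegularity.Theorems.PowerGaugeEulerLiouville.Negative
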